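import Summits.Ventures.QEC.Census.CertCheckBZAutSound
import Summits.Ventures.QEC.Census.BB.BB144.OrbitBZCover
import Summits.Ventures.QEC.Census.BB.BB108.BZAutData
import Summits.Ventures.QEC.Census.BB.BB108Rank
import Literature.InformationTheory.QuantumCodes.HypergraphProductKernels
import HarnessLib

/-!
# `[[108,8,10]]` — the `bz_aut` LOWER BOUND assembled in the kernel, modulo the per-block enumeration verdicts
# (route BB108DistanceCertificate item NoZLogicalBelowTen108, stmt-Ventures-19828; director-qec g2 22:52:31Z R2(3))

Data: `BB108.cert : DistCert` and `BB108.bzAutData : BZData`, both of the kernel-A certificate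
`cert/search-10/bb108-bzaut3/BB108.bzaut3.certA.json` (`e12036534ff94c78…`, method `bz_aut` with parity witness:
THREE representative Brouwer–Zimmermann blocks of the `Z` side — a cover of the 35 orbits of the 54 translations of
`ℤ₉ × ℤ₆` on the 255 nonzero labels by three 4-dimensional label subspaces (qec-search-10, `census/search-10/bz/`),
built on qec-search-1's kernel-A conventions and VERIFIED by its `verify_cert.py`; emitted with qec-search-7's
`emit_lean.py` / `emit_bz.py`). This file is the `[[144,12,12]]` template `Theorems/BB144DistanceCertificateLowerZ.lean`
(qec-type-10) at `(ℓ, m) = (9, 6)` with ONE difference: the label cover `coverAut_ok` is `decide +kernel` here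
(255 labels × 54 translations), so EVERY conjunct is tier KERNEL (axioms standard, no `native_decide`):

  `lowerZ_of_blocks : (∀ b < 3, cert.bzZBlock bzAutData b = true) →
     ∀ w, H^X w = 0 → w ∉ rowspace H^Z → 9 < |w|`     (flat indices, the certificate's own matrices),

by `bzAut_lower_sound` (type-10, `Census/CertCheckBZAutSound.lean`) with
* structure: `core_ok` (rank certificates `r = 50` each — type-02 `RankCert` —, the `LX`/`LZ` pairing,
  `108 = 50 + 50 + 8`, the parity witness — type-06), `len_ok`, `foundZ_ok` (the 54-entry allow-list = the rows of
  `H^Z`), all `decide +kernel`;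
* transports = the 54 flat translations of `ℤ₉ × ℤ₆` (type-07 `BB.translateFlat`, type-12 `OrbitBZ`);
* cover: type-12's `coverAutOK` over all 54 translations, `decide +kernel`, read through `coverAutOK_sound`.
The certificate's check words ARE type-02's `Census.bb108HX` / `bb108HZ` (`cert_HX`, `cert_HZ`, by `rfl`), so the
index identity `rowMatrix 108 cert.HX/HZ = BB.bb108.HXFlat/HZFlat` is type-02's `rowMatrix_bb108HX/HZ`
(`Census/BB/BB108Rank.lean`) and the commutation follows from type-05's `HXFlat_mul_HZFlat_transpose` (as type-10's `comm_flat108`). The closer of the route item imports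
this file and the emitted KERNEL verdict files (`cert.bzZSys/bzZEnum/bzZBound`, `BZAutInfoSetsZ1`, `BZAutEnumZ01…06`,
`BZAutBoundsZ`) and assembles them with `DistCert.bzZBlock_of_parts`.
-/

namespace Summit.Ventures.QEC.Census.BB108

open Matrix Literature.InformationTheory.QuantumCodes Literature.InformationTheory.QuantumCodes.BB

/-! ## The certificate's words are type-02's words -/

/-- The certificate's `H^X` rows are the words `Census.bb108HX` of `Census/BB/BB108Rank.lean` (same generator file,
same bit convention). -/
theorem cert_HX : BB108.cert.HX = bb108HX := rfl

/-- The certificate's `H^Z` rows are the words `Census.bb108HZ`. -/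
theorem cert_HZ : BB108.cert.HZ = bb108HZ := rfl

/-- The certificate has `n = 108` qubits. -/
theorem cert_n : BB108.cert.n = 108 := rfl

/-- Commutation of the certificate's check matrices (type-02's identities + type-05's `BB.Code.HXFlat_mul_HZFlat_transpose`; = type-10's `comm_flat108`, restated here to keep this file off the route cone). -/
theorem comm_flat : rowMatrix BB108.cert.n BB108.cert.HX * (rowMatrix BB108.cert.n BB108.cert.HZ)ᵀ = 0 := by
  change rowMatrix 108 bb108HX * (rowMatrix 108 bb108HZ)ᵀ = 0
  rw [rowMatrix_bb108HX, rowMatrix_bb108HZ]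
  exact BB.bb108.HXFlat_mul_HZFlat_transpose

/-- Index identity, `X` checks: the certificate's matrix is the typed code's flat matrix (type-02). -/
theorem HX_eq_flat : rowMatrix BB108.cert.n BB108.cert.HX = BB.bb108.HXFlat := rowMatrix_bb108HX

/-- Index identity, `Z` checks. -/
theorem HZ_eq_flat : rowMatrix BB108.cert.n BB108.cert.HZ = BB.bb108.HZFlat := rowMatrix_bb108HZ

/-! ## The cheap structural facts (KERNEL) -/

/-- Core structural check of the `Z` side of the `bz_aut` data: rank certificates of `H^X`, `H^Z` (`r = 50` each),
pairing of `LZ`/`LX`, `108 = 50 + 50 + 8`, parity witness (`⊕` of the listed `H^X` rows `= 𝟙`). -/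
theorem core_ok : bzCoreOK BB108.cert.n BB108.cert.HX BB108.cert.HZ BB108.bzAutData.rcX BB108.bzAutData.rcZ BB108.bzAutData.LZ BB108.bzAutData.LX
    BB108.bzAutData.sideZ.evenWitness = true := by
  decide +kernel

/-- Every matrix of every representative block has `kb = |G_b|` rows. -/
theorem len_ok : BB108.cert.bzZLen BB108.bzAutData = true := by
  decide +kernel

/-- The `Z` allow-list (the 54 rows of `H^Z`) decomposes over the rows of `H^Z`. -/
theorem foundZ_ok : foundOK BB108.cert.HZ BB108.cert.sideZ.found = true := by
  decide +kernel

/-- The pairing check alone (for the label-action lemma). -/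
theorem logZ_ok : logOK BB108.cert.n BB108.cert.HX BB108.cert.HZ BB108.bzAutData.LZ BB108.bzAutData.LX = true := by
  decide +kernel

/-- The structural check of the distance certificate itself (O2 commutation, O5 witnesses, C1 allow-lists). -/
theorem structure_ok : BB108.cert.checkStructure = true := by
  decide +kernel

/-! ## The certificate's code on flat indices -/

/-- The certificate's CSS code on flat indices. -/
abbrev flatCode : CSSCode (Fin BB108.cert.HX.length) (Fin BB108.cert.HZ.length) (Fin BB108.cert.n) :=
  CSSCode.ofMatrices (rowMatrix BB108.cert.n BB108.cert.HX) (rowMatrix BB108.cert.n BB108.cert.HZ) comm_flat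

/-! ## The label cover by translations (KERNEL) -/

/-- All `54` translations of `ℤ₉ × ℤ₆` as pairs `(t₁, t₂)` (the identity included, harmlessly). -/
def taus : List (ℕ × ℕ) := (List.range 9).flatMap fun a => (List.range 6).map fun b => (a, b)

set_option maxHeartbeats 1000000 in
/-- **C5 with automorphisms** (type-12 `coverAutOK`): every nonzero label, or one of its 54 translates, lies in the
label span of one of the 3 representative blocks — `decide +kernel` (255 labels × ≤ 54 probes of 108-bit word
transports; ≈ 1 min on the farm; `maxHeartbeats` raised for the single evaluation, as in the enumeration files). -/
theorem coverAut_ok : coverAutOK 9 6 BB108.bzAutData.LX BB108.bzAutData.LZ taus BB108.bzAutData.sideZ.blocks = true := by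
  decide +kernel

/-! ## Assembly -/

/-- The dual (label) matrix `LX` of the `Z` side as a matrix over the flat qubits. -/
abbrev LXmat : Matrix (Fin BB108.bzAutData.LZ.length) (Fin BB108.cert.n) (ZMod 2) := ldMat BB108.cert.n BB108.bzAutData.LZ BB108.bzAutData.LX

/-- The logical matrix `LZ` (rows `logVec`). -/
abbrev LZmat : Matrix (Fin BB108.bzAutData.LZ.length) (Fin BB108.cert.n) (ZMod 2) := fun i => logVec BB108.cert.n BB108.bzAutData.LZ i

/-- The inverse flat translation as a function on the certificate's qubit index type. -/
def sigmaInv (t : Mono 9 6) : Fin BB108.cert.n → Fin BB108.cert.n := fun q => (BB.translateFlat t).symm q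

/-- The pairing in matrix form: `LX · LZᵀ = 1`. -/
theorem LX_mul_LZ_transpose : LXmat * LZmatᵀ = 1 := by
  ext j i
  rw [Matrix.mul_apply', Matrix.one_apply]
  change ldMat BB108.cert.n BB108.bzAutData.LZ BB108.bzAutData.LX j ⬝ᵥ logVec BB108.cert.n BB108.bzAutData.LZ i = _
  rw [ldMat, dual_dotProduct_logVec logZ_ok i j]
  by_cases h : i = j
  · subst h; simp
  · rw [if_neg h, if_neg (fun e => h e.symm)]

/-- **The lower bound modulo the block verdicts**: if the three representative `Z` blocks replay
(`cert.bzZBlock BB108.bzAutData b = true`, `b < 3`; assembled from the KERNEL files `bzZSys`/`bzZEnum`/`bzZBound` by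
`DistCert.bzZBlock_of_parts`), then every non-trivial flat `Z`-logical of the certificate's code has weight `> 9`. -/
theorem lowerZ_of_blocks (hblocks : ∀ b : ℕ, b < BB108.bzAutData.sideZ.blocks.length → BB108.cert.bzZBlock BB108.bzAutData b = true)
    (w : Fin BB108.cert.n → ZMod 2) (hw : rowMatrix BB108.cert.n BB108.cert.HX *ᵥ w = 0)
    (hw' : w ∉ rowSpace (rowMatrix BB108.cert.n BB108.cert.HZ)) : BB108.cert.dZ - 1 < hammingNorm w := by
  -- structural facts unpacked once
  have hcore := core_ok
  simp only [bzCoreOK, Bool.and_eq_true, beq_iff_eq] at hcore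
  obtain ⟨⟨⟨⟨hY, hS⟩, hL⟩, hdim⟩, -⟩ := hcore
  -- the label-action ingredients
  have hLX : ∀ a, flatCode.HZ *ᵥ LXmat a = 0 := fun a => mulVec_dual_eq_zero hL a
  have hexp : ∀ z, flatCode.HX *ᵥ z = 0 → z - (LXmat *ᵥ z) ᵥ* LZmat ∈ flatCode.rowSpZ := fun z hz =>
    flatCode.sub_label_vecMul_mem_rowSpZ hLX LX_mul_LZ_transpose (exists_coeffs_of_ker comm_flat hY hS hL hdim hz)
  refine bzAut_lower_sound (s := BB108.bzAutData.sideZ) comm_flat foundZ_ok core_ok len_ok hblocks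
    (α := {t : Mono 9 6 // (((t.1 : Fin 9) : ℕ), ((t.2 : Fin 6) : ℕ)) ∈ taus})
    (fun a z => z ∘ sigmaInv a.1)
    (fun a => LXmat * (LZmat.submatrix id (sigmaInv a.1))ᵀ)
    (fun a z hz hz' => ?_) (fun lam hlam => ?_) w hw hw'
  · -- transport by the translation `a.1`: row-map automorphism facts on the certificate's matrices
    have hXsub : flatCode.HX.submatrix (BB.checkTranslateFlat a.1) (BB.translateFlat a.1) = flatCode.HX := by
      have h := BB.HXFlat_submatrix_translateFlat BB.bb108 a.1
      rw [← HX_eq_flat] at h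
      exact h
    have hZsub : flatCode.HZ.submatrix (BB.checkTranslateFlat a.1) (BB.translateFlat a.1) = flatCode.HZ := by
      have h := BB.HZFlat_submatrix_translateFlat BB.bb108 a.1
      rw [← HZ_eq_flat] at h
      exact h
    obtain ⟨h1, h2⟩ := flatCode.zLogical_comp_equiv_symm_of_rowMap hXsub hZsub ⟨hz, hz'⟩
    exact ⟨h1, h2, hammingNorm_comp_equiv z (BB.translateFlat a.1 : Fin BB108.cert.n ≃ Fin BB108.cert.n),
      flatCode.label_comp_equiv_symm hLX hexp hZsub hz⟩
  · -- cover by translates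
    rcases coverAutOK_sound (ℓ := 9) (m := 6) coverAut_ok
        (P := fun μ => ∃ b : Fin BB108.bzAutData.sideZ.blocks.length, μ ∈ Submodule.span (ZMod 2)
          (Set.range fun l : Fin (BB108.bzAutData.sideZ.blocks[b]).W.length =>
            ofBits BB108.bzAutData.LZ.length (BB108.bzAutData.sideZ.blocks[b]).W[l]))
        (fun v hv => testBit_coverMask_imp_exists_span _ _ hv)
        (Ld' := LXmat) (L' := LZmat) (fun i => rfl)
        (fun j => by
          change ofBits BB108.cert.n BB108.bzAutData.LZ[j] = ofBits BB108.cert.n (BB108.bzAutData.LZ.getD j 0)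
          rw [List.getD_eq_getElem?_getD, List.getElem?_eq_getElem j.2, Option.getD_some]
          rfl)
        lam hlam with hP | ⟨t, ht, hPt⟩
    · exact Or.inl hP
    · obtain ⟨b, hb⟩ := hPt
      exact Or.inr ⟨⟨t, ht⟩, b, hb⟩

/-- The same bound as `10 ≤ |w|` (`cert.dZ = 10`). -/
theorem ten_le_of_blocks (hblocks : ∀ b : ℕ, b < BB108.bzAutData.sideZ.blocks.length → BB108.cert.bzZBlock BB108.bzAutData b = true)
    (w : Fin BB108.cert.n → ZMod 2) (hw : rowMatrix BB108.cert.n BB108.cert.HX *ᵥ w = 0)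
    (hw' : w ∉ rowSpace (rowMatrix BB108.cert.n BB108.cert.HZ)) : 10 ≤ hammingNorm w := by
  have := lowerZ_of_blocks hblocks w hw hw'
  change 10 - 1 < hammingNorm w at this
  omega

/-- **Transport to the typed code**: the block verdicts give the route statement's shape on `BB.bb108` itself —
every `Z`-type logical operator of `QC(x³+y+y², y³+x+x²)` on `ℤ₉ × ℤ₆` has weight `≥ 10` (type-05's
`BB.Code.zLowerBound_of_flat` along the index identities). -/
theorem ten_le_bb108_of_blocks
    (hblocks : ∀ b : ℕ, b < BB108.bzAutData.sideZ.blocks.length → BB108.cert.bzZBlock BB108.bzAutData b = true) :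
    ∀ v : Mono 9 6 ⊕ Mono 9 6 → ZMod 2, BB.bb108.css.HX *ᵥ v = 0 → v ∉ BB.bb108.css.rowSpZ → 10 ≤ hammingNorm v :=
  BB.bb108.zLowerBound_of_flat (D := flatCode) HX_eq_flat HZ_eq_flat (ten_le_of_blocks hblocks)

end Summit.Ventures.QEC.Census.BB108
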